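import Literature.Computability.AlgebraicComplexity.PlethysmTableauPerms
import Literature.Computability.AlgebraicComplexity.TableauPolynomial
import Mathlib.Data.List.GetD
import HarnessLib

/-!
# Bridge: the kernel evaluator `evalC` computes the mathematical evaluator `TabM.EC`

Lean checker of the GCT multiplicity-obstruction engine (cell `pub-gct`; honest framing: rung-1
multiplicity-obstruction search for permanent versus determinant at small `(n, m)`, no claim about
VP ≠ VNP or P ≠ NP), step H1d. The kernel-side evaluator `TableauEval.evalC`
(`PlethysmTableauEvaluation.lean`) works on lists of natural-number variable indices; the
mathematical layer (`TableauPolynomial.lean`) on functions into a finite variable type `σ`. Given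
an enumeration `E : Enum σ N` of `σ` by `0, …, N-1` (`E.x`, with inverse `E.xinv`) this file
proves, for a list point `P` all of whose terms have `m` forms and a list network `N` passing its
structural check with variables `< N`,

  `evalC P N = ∑_{π} (∏_i sign π_i) · ∏_{u<d} S(α_u(π))`,  `S(α) = α! · coeff_α (splfPoly P)`

(`evalC_eq_sum_S`): a closed form over tuples of column bijections `π : ∀ i : Fin C, Perm (Fin hᵢ)`
in which only the CONTENTS `α_u(π) = ∑_{boxes b labelled u} e_{x(var_b(π))}` of the label words
enter — by the polarisation identity (`symEntryM_eq`) the symmetric-tensor entry depends on a word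
only through its content, so the order in which the program accumulates letters is irrelevant.
Ingredients: the master lemma `sum_permsSign_ofFn` (one column's signed list enumeration = sum over
`Perm (Fin h)`), `lperm_eq_permanent` (`symEntry = symEntryM`, `symEntry_eq_S`), the content
bookkeeping of `pushAll` (`contentL_pushAll`), and `Fin.consEquiv` to peel off columns. The
identification of this closed form with `TabM.EC` of the corresponding tableau datum is
`TabM.EC_eq_sum_S` (same contents, via a frame). Elementary [folklore].
-/

noncomputable section

open scoped BigOperators

namespace Literature.Computability.AlgebraicComplexity

namespace TableauEval

open MvPolynomial

variable {σ : Type*} [Fintype σ] [DecidableEq σ] {K : Type*} [CommRing K]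

/-! ## §1 Enumerations and the mathematical presentation of a list point -/

/-- An enumeration of the finite variable type `σ` by `0, …, N-1` with an explicit inverse.
[folklore] -/
structure Enum (σ : Type*) (N : ℕ) where
  /-- index ↦ variable -/
  x : ℕ → σ
  /-- variable ↦ index -/
  xinv : σ → ℕ
  /-- indices are `< N` -/
  xinv_lt : ∀ v, xinv v < N
  /-- right inverse -/
  x_xinv : ∀ v, x (xinv v) = v
  /-- left inverse on `[0, N)` -/
  xinv_x : ∀ i, i < N → xinv (x i) = i

variable {Nv : ℕ} (E : Enum σ Nv)

/-- Coefficients of the mathematical presentation of a list point. [folklore] -/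
def coefM (P : Point K) : Fin P.terms.length → K := fun t => (P.terms.get t).1

/-- Linear forms of the mathematical presentation of a list point: the `s`-th form of term `t`,
read at the variable `v` through its index `E.xinv v` (zero beyond the list). [folklore] -/
def formM (P : Point K) (m : ℕ) : Fin P.terms.length → Fin m → σ → K :=
  fun t s v => (((P.terms.get t).2.getD s []).getD (E.xinv v) 0)

/-- `S(α) = α! · coeff_α (form presented by P)`. [folklore] -/
def Sfun (P : Point K) (m : ℕ) (α : σ →₀ ℕ) : K :=
  (ffact α : K) * coeff α (splfPoly (coefM P) (formM E P m))

/-- The content `∑_j e_{x (l_j)}` of a list of variable indices. [folklore] -/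
def contentL (l : List ℕ) : σ →₀ ℕ := (l.map fun i => Finsupp.single (E.x i) 1).sum

omit [Fintype σ] [DecidableEq σ] in
/-- `contentL` of a cons. [folklore] -/
theorem contentL_cons (i : ℕ) (l : List ℕ) :
    contentL E (i :: l) = Finsupp.single (E.x i) 1 + contentL E l := by
  simp [contentL]

omit [Fintype σ] [DecidableEq σ] in
/-- `contentL` is the word content of the looked-up word. [folklore] -/
theorem contentL_eq_wordContent (l : List ℕ) :
    contentL E l = wordContent fun s : Fin l.length => E.x (l.get s) := by
  rw [contentL, wordContent, ← List.sum_ofFn]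
  congr 1
  conv_lhs => rw [← List.ofFn_getElem (xs := l)]
  rw [List.map_ofFn]
  rfl

/-- A list sum over `map` is a `Fin`-indexed sum over `get`. [folklore] -/
theorem sum_map_eq_sum_get {α M : Type*} [AddCommMonoid M] (l : List α) (f : α → M) :
    (l.map f).sum = ∑ i : Fin l.length, f (l.get i) := by
  rw [← List.sum_ofFn]
  congr 1
  conv_lhs => rw [← List.ofFn_getElem (xs := l)]
  rw [List.map_ofFn]
  rfl

/-- A list product over `map` is a `Fin`-indexed product over `get`. [folklore] -/
theorem prod_map_eq_prod_get {α M : Type*} [CommMonoid M] (l : List α) (f : α → M) :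
    (l.map f).prod = ∏ i : Fin l.length, f (l.get i) := by
  rw [← List.prod_ofFn]
  congr 1
  conv_lhs => rw [← List.ofFn_getElem (xs := l)]
  rw [List.map_ofFn]
  rfl

/-- `List.getD_map` with the default rewritten along `g d = d'`. [folklore] -/
theorem getD_map_congr {α β : Type*} (g : α → β) {d : α} {d' : β} (h : g d = d') (l : List α)
    (i : ℕ) : (l.map g).getD i d' = g (l.getD i d) := by
  rw [← h]; exact List.getD_map l d g

/-- **`symEntry = S(content)`**: for a list point whose terms all have `m` forms and a word of
`m` indices `< N`, the kernel's symmetric-tensor entry is `α! · coeff_α` of the presented form at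
the content `α` of the word (`lperm_eq_permanent` + polarisation `symEntryM_eq`). [folklore] -/
theorem symEntry_eq_S (P : Point K) {m : ℕ} (hP : ∀ t : Fin P.terms.length, (P.terms.get t).2.length = m)
    (idx : List ℕ) (hlen : idx.length = m) (hidx : ∀ i ∈ idx, i < Nv) :
    symEntry P idx = Sfun E P m (contentL E idx) := by
  -- the looked-up word
  subst hlen
  set w : Fin idx.length → σ := fun s => E.x (idx.get s) with hw
  have hmat : ∀ t : Fin P.terms.length,
      lperm ((P.terms.get t).2.map fun ℓ => idx.map fun i => ℓ.getD i 0) =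
        (Matrix.of fun s s' : Fin idx.length => formM E P idx.length t s (w s')).permanent := by
    intro t
    rw [lperm_eq_permanent _ (by rw [List.length_map, hP t])]
    congr 1
    ext s s'
    have hs : (s : ℕ) < (P.terms.get t).2.length := by rw [hP t]; exact s.isLt
    have h1 : (((P.terms.get t).2.map fun ℓ => idx.map fun i => ℓ.getD i 0).getD s []) =
        idx.map fun i => ((P.terms.get t).2.get ⟨s, hs⟩).getD i 0 := by
      rw [List.getD_eq_getElem _ _ (by rw [List.length_map]; exact hs), List.getElem_map]; rfl
    have h2 : (idx.map fun i => ((P.terms.get t).2.get ⟨s, hs⟩).getD i 0).getD s' 0 =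
        ((P.terms.get t).2.get ⟨s, hs⟩).getD (idx.get s') 0 := by
      rw [List.getD_eq_getElem _ _ (by rw [List.length_map]; exact s'.isLt), List.getElem_map]
      rfl
    have h3 : (P.terms.get t).2.getD s [] = (P.terms.get t).2.get ⟨s, hs⟩ := by
      rw [List.getD_eq_getElem _ _ hs]; rfl
    simp only [matOfRows, Matrix.of_apply, formM, hw]
    rw [h1, h2, h3, E.xinv_x _ (hidx _ (List.get_mem idx s'))]
  unfold symEntry Sfun
  rw [sum_map_eq_sum_get, contentL_eq_wordContent, ← symEntryM_eq]
  unfold symEntryM coefM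
  refine Finset.sum_congr rfl fun t _ => ?_
  rw [hmat t]

/-! ## §2 Contents of the accumulated words -/

omit [Fintype σ] [DecidableEq σ] in
/-- `consAt` changes the content of exactly one accumulated word. [folklore] -/
theorem contentL_consAt_getD : ∀ (acc : List (List ℕ)) (u i u' : ℕ), u' < acc.length →
    contentL E ((consAt acc u i).getD u' []) =
      contentL E (acc.getD u' []) + if u' = u then Finsupp.single (E.x i) 1 else 0
  | [], _, _, _, h => absurd h (Nat.not_lt_zero _)
  | l :: ls, 0, i, 0, _ => by simp [consAt, contentL_cons, add_comm]
  | l :: ls, 0, i, u' + 1, _ => by simp [consAt]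
  | l :: ls, u + 1, i, 0, _ => by simp [consAt]
  | l :: ls, u + 1, i, u' + 1, h => by
    rw [consAt, List.getD_cons_succ, List.getD_cons_succ,
      contentL_consAt_getD ls u i u' (by simpa using h)]
    simp

omit [Fintype σ] [DecidableEq σ] in
/-- `consAt` preserves the number of accumulated words. [folklore] -/
theorem length_consAt : ∀ (acc : List (List ℕ)) (u i : ℕ), (consAt acc u i).length = acc.length
  | [], _, _ => rfl
  | _ :: _, 0, _ => rfl
  | _ :: ls, u + 1, i => by simp [consAt, length_consAt ls u i]

omit [Fintype σ] [DecidableEq σ] in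
/-- `pushAll` preserves the number of accumulated words. [folklore] -/
theorem length_pushAll : ∀ (acc : List (List ℕ)) (us is : List ℕ),
    (pushAll acc us is).length = acc.length
  | acc, [], _ => by cases ‹List ℕ› <;> rfl
  | acc, _ :: _, [] => rfl
  | acc, u :: us, i :: is => by rw [pushAll, length_pushAll, length_consAt]

omit [Fintype σ] [DecidableEq σ] in
/-- **Content bookkeeping of `pushAll`**: feeding the rows of a column (labels `us`, variables
`is`, same length) adds `e_{x i_r}` to the word of label `u_r` for every row `r`. [folklore] -/
theorem contentL_pushAll_getD : ∀ (acc : List (List ℕ)) (us is : List ℕ), us.length = is.length →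
    ∀ u : ℕ, u < acc.length →
      contentL E ((pushAll acc us is).getD u []) =
        contentL E (acc.getD u []) +
          (List.zipWith (fun u' i => if u = u' then Finsupp.single (E.x i) 1 else 0) us is).sum
  | acc, [], [], _, u, _ => by simp [pushAll]
  | acc, [], _ :: _, h, _, _ => absurd h (by simp)
  | acc, _ :: _, [], h, _, _ => absurd h (by simp)
  | acc, u' :: us, i :: is, h, u, hu => by
    rw [pushAll, contentL_pushAll_getD (consAt acc u' i) us is (by simpa using h) u
      (by rw [length_consAt]; exact hu), List.zipWith_cons_cons, List.sum_cons, ← add_assoc]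
    congr 1
    rw [contentL_consAt_getD E acc u' i u hu]

/-! ## §3 The column recursion as a sum over tuples of column bijections -/

/-- Tuples of column bijections for a list of program columns: `π i ∈ 𝔖_{|vars of column i|}`.
[folklore] -/
abbrev BijL (cs : List Column) : Type := (i : Fin cs.length) → Equiv.Perm (Fin (cs.get i).vars.length)

/-- The sign of a tuple of column bijections, in `K`. [folklore] -/
def sgnL (cs : List Column) (π : BijL cs) : K := ∏ i, ((Equiv.Perm.sign (π i) : ℤ) : K)

/-- The variables of column `c` in the order given by a bijection. [folklore] -/
def permVars (c : Column) (π : Equiv.Perm (Fin c.vars.length)) : List ℕ :=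
  List.ofFn fun r => c.vars.get (π r)

/-- The accumulated words after feeding all columns with the bijections `π` (the program's own
accumulation order). [folklore] -/
def finalAcc : (cs : List Column) → BijL cs → List (List ℕ) → List (List ℕ)
  | [], _, acc => acc
  | c :: cs, π, acc =>
    finalAcc cs (fun i => π i.succ) (pushAll acc c.labels (permVars c (π 0)))

/-- **The column recursion is a signed sum over tuples of column bijections** (master lemma
`sum_permsSign_ofFn` column by column, `Fin.consEquiv` to assemble the tuple). [folklore] -/
theorem evalCols_eq_sum (P : Point K) : ∀ (cs : List Column) (acc : List (List ℕ)),
    evalCols P cs acc = ∑ π : BijL cs, sgnL cs π * ((finalAcc cs π acc).map (symEntry P)).prod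
  | [], acc => by
    rw [evalCols]
    have h : ∀ π : BijL ([] : List Column),
        sgnL [] π * ((finalAcc [] π acc).map (symEntry P)).prod = (acc.map (symEntry P)).prod :=
      fun π => by simp [sgnL, finalAcc]
    rw [Finset.sum_congr rfl (fun π _ => h π), Finset.sum_const, Finset.card_univ]
    simp [Fintype.card_pi]
  | c :: cs, acc => by
    rw [evalCols]
    conv_lhs => rw [← List.ofFn_getElem (xs := c.vars)]
    rw [sum_permsSign_ofFn]
    simp only [sgn_decide_sign, evalCols_eq_sum P cs, Finset.mul_sum]
    -- the right-hand side, split along `Fin.consEquiv`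
    let α : Fin (cs.length + 1) → Type := fun i => Equiv.Perm (Fin ((c :: cs).get i).vars.length)
    let G : ((i : Fin (cs.length + 1)) → α i) → K := fun π =>
      sgnL (c :: cs) π * ((finalAcc (c :: cs) π acc).map (symEntry P)).prod
    have key : ∑ π : BijL (c :: cs), sgnL (c :: cs) π * ((finalAcc (c :: cs) π acc).map
        (symEntry P)).prod = ∑ p : α 0 × ((i : Fin cs.length) → α i.succ), G (Fin.consEquiv α p) :=
      ((Fin.consEquiv α).sum_comp G).symm
    rw [key, Fintype.sum_prod_type]
    refine Finset.sum_congr rfl fun π₀ _ => Finset.sum_congr rfl fun π' _ => ?_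
    have hsgn : sgnL (c :: cs) (Fin.consEquiv α (π₀, π')) =
        ((Equiv.Perm.sign π₀ : ℤ) : K) * sgnL cs π' := by
      unfold sgnL
      exact Fin.prod_univ_succ fun i : Fin (cs.length + 1) =>
        ((Equiv.Perm.sign ((Fin.consEquiv α (π₀, π')) i) : ℤ) : K)
    have hfin : finalAcc (c :: cs) (Fin.consEquiv α (π₀, π')) acc =
        finalAcc cs π' (pushAll acc c.labels (permVars c π₀)) := rfl
    change _ = G (Fin.consEquiv α (π₀, π'))
    simp only [G, hsgn, hfin, mul_assoc]
    rfl

omit [Fintype σ] [DecidableEq σ] in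
/-- `finalAcc` keeps the number of words. [folklore] -/
theorem length_finalAcc : ∀ (cs : List Column) (π : BijL cs) (acc : List (List ℕ)),
    (finalAcc cs π acc).length = acc.length
  | [], _, _ => rfl
  | c :: cs, π, acc => by rw [finalAcc, length_finalAcc, length_pushAll]

/-- The content a column adds to the word of label `u` under the bijection `π`. [folklore] -/
def colContent (c : Column) (π : Equiv.Perm (Fin c.vars.length)) (u : ℕ) : σ →₀ ℕ :=
  (List.zipWith (fun u' i => if u = u' then Finsupp.single (E.x i) 1 else 0)
    c.labels (permVars c π)).sum

omit [Fintype σ] [DecidableEq σ] in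
/-- **Contents of the final words**: the word of label `u` gains `colContent` from every column.
[folklore] -/
theorem contentL_finalAcc : ∀ (cs : List Column) (_ : ∀ c ∈ cs, c.vars.length = c.labels.length)
    (π : BijL cs) (acc : List (List ℕ)) (u : ℕ), u < acc.length →
    contentL E ((finalAcc cs π acc).getD u []) =
      contentL E (acc.getD u []) + ∑ i, colContent E (cs.get i) (π i) u
  | [], _, _, _, _, _ => by simp [finalAcc]
  | c :: cs, hcs, π, acc, u, hu => by
    have hsplit : (∑ i : Fin (c :: cs).length, colContent E ((c :: cs).get i) (π i) u) =
        colContent E c (π 0) u + ∑ i : Fin cs.length, colContent E (cs.get i) (π i.succ) u :=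
      Fin.sum_univ_succ fun i : Fin (cs.length + 1) => colContent E ((c :: cs).get i) (π i) u
    rw [hsplit, finalAcc, contentL_finalAcc cs (fun c' hc' => hcs c' (List.mem_cons_of_mem _ hc'))
      _ _ u (by rw [length_pushAll]; exact hu),
      contentL_pushAll_getD E acc c.labels (permVars c (π 0))
        (by rw [permVars, List.length_ofFn, (hcs c List.mem_cons_self).symm]) u hu,
      add_assoc]
    rfl

end TableauEval

end Literature.Computability.AlgebraicComplexity

end
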